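import Mathlib
import Literature.MathematicalPhysics.QuantumFieldTheory.YangMillsOS
import Literature.MathematicalPhysics.QuantumFieldTheory.LatticeGaugeProofs
import HarnessLib

/-!
# The rescaled lattice two-point function as a double sum of torus covariances
# (support file for `StrongCouplingIRTrivial`)

Route `InfraredLiouville` of `YangMills`, support item `stmt-QuantumFields-9708`
(`Summit.QuantumFields.YangMills.Theses.InfraredLiouville.StrongCouplingIRTrivial`).

For a sequential scheme `sch` and two species `σ₀, σ₁` with observables `O₀, O₁`, the joint
lattice two-point function of the tree (`latticeSchwinger`, `n = 2`) is, by definition, the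
torus expectation of the product of the two smeared centred fields
`Φᵢ = cᵢ a⁴ ∑ₓ gᵢ(a x) (Oᵢ(τ₋ₓ Ũ) − mᵢ)`. This file rewrites it as
`c₀ c₁ a⁸ ∑ₓ ∑_y g₀(a x) g₁(a y) K(x, y)` (`latticeSchwinger_two_eq`) with the centred kernel
`K(x, y) = ⟨(O₀ ∘ τ₋ₓ − m₀)(O₁ ∘ τ₋y − m₁)⟩` (`centredKernel`), and shows that under EXACT
centring `mᵢ = ⟨Oᵢ⟩` the kernel is the torus truncated correlation of `O₀` and `O₁ ∘ τ_{x−y}`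
(`centredKernel_eq_cov`; translation invariance of the torus Wilson state, tree
`wilsonExpectation_comp_torusConfigShift`). Consequently a clustering bound for displacements
of at most half the period transfers to the kernel (`abs_centredKernel_le`).

Only tree definitions/theorems (`YangMillsOS`, `LatticeGaugeProofs`) and Mathlib are used; no
named facts.
-/

noncomputable section

open scoped SchwartzMap BigOperators
open MeasureTheory Finset
open Literature.MathematicalPhysics.QuantumFieldTheory Literature.MathematicalPhysics.QuantumLattice
open Literature.Probability.LatticeModels (Site box mem_box Torus.proj)

namespace Summit.QuantumFields.YangMills.Theorems.StrongCouplingIRTrivial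

namespace TwoPoint

/-- Composition of lattice translations: `τ_v ∘ τ_w = τ_{v+w}`. [folklore] -/
theorem configShift_configShift {G : Type} [MeasurableSpace G] {d : ℕ} (v w : Site d)
    (U : LGConfig d G) : configShift v (configShift w U) = configShift (v + w) U := by
  funext e
  simp only [configShift_apply, sub_sub]

/-- Product of two scaled finite sums as a double sum. [folklore] -/
theorem mul_sum_mul_mul_sum {α : Type*} (s : Finset α) (p q : ℝ) (F H : α → ℝ) :
    (p * ∑ x ∈ s, F x) * (q * ∑ y ∈ s, H y) = ∑ x ∈ s, ∑ y ∈ s, p * q * (F x * H y) := by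
  rw [mul_mul_mul_comm, Finset.sum_mul_sum, Finset.mul_sum]
  refine Finset.sum_congr rfl fun x _ => ?_
  rw [Finset.mul_sum]

variable {G : Type} [Group G] [TopologicalSpace G] [IsTopologicalGroup G] [CompactSpace G]
  [MeasurableSpace G] [BorelSpace G] {N : ℕ} (ρ : G →* Matrix (Fin N) (Fin N) ℂ)

/-- The **centred kernel** `K(x, y) = ∫ (O₀(τ₋ₓ Ũ) − m₀) (O₁(τ₋y Ũ) − m₁) dμ_{S,β}` on the torus of
side `S` (periodic lift `Ũ = torusLift S U`). [folklore] -/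
def centredKernel (β : ℝ) (S : ℕ) [NeZero S] (O₀ O₁ : LGConfig 4 G → ℝ) (m₀ m₁ : ℝ)
    (x y : Site 4) : ℝ :=
  ∫ U, (O₀ (configShift (-x) (torusLift S U)) - m₀) * (O₁ (configShift (-y) (torusLift S U)) - m₁)
    ∂(wilsonMeasure (d := 4) (L := S) ρ β)

/-- A bounded measurable observable, shifted and lifted, is integrable for the torus Wilson state.
[folklore] -/
theorem integrable_shift_lift (hρ : Continuous ρ) (β : ℝ) (S : ℕ) [NeZero S]
    {O : LGConfig 4 G → ℝ} (hO : Measurable O) (hb : ∃ C, ∀ U, |O U| ≤ C) (x : Site 4) (m : ℝ) :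
    Integrable (fun U : GaugeConfig 4 S G => O (configShift (-x) (torusLift S U)) - m)
      (wilsonMeasure (d := 4) (L := S) ρ β) := by
  haveI := isProbabilityMeasure_wilsonMeasure (d := 4) (L := S) ρ hρ β
  obtain ⟨C, hC⟩ := hb
  have hmeas : Measurable fun U : GaugeConfig 4 S G => O (configShift (-x) (torusLift S U)) - m :=
    (hO.comp ((configShift (-x)).measurable.comp (measurable_torusLift S))).sub measurable_const
  refine Integrable.of_bound hmeas.aestronglyMeasurable (C + |m|) (ae_of_all _ fun U => ?_)
  rw [Real.norm_eq_abs]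
  exact (abs_sub _ _).trans (add_le_add (hC _) le_rfl)

/-- **The lattice two-point function as a double sum.** For `n = 2`,
`latticeSchwinger = c₀ c₁ a⁸ ∑ₓ ∑_y g₀(a x) g₁(a y) K(x, y)` with the centred kernel `K`.
[folklore] -/
theorem latticeSchwinger_two_eq (hρ : Continuous ρ) {ι : Type} (sch : SpeciesScheme ι)
    (obs : ι → LGConfig 4 G → ℝ) (k : ℕ) (σ : Fin 2 → ι)
    (g : Fin 2 → 𝓢(EuclideanSpace ℝ (Fin 4), ℝ))
    (hmeas : ∀ i, Measurable (obs (σ i))) (hbdd : ∀ i, ∃ C, ∀ U, |obs (σ i) U| ≤ C) :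
    latticeSchwinger ρ sch obs k 2 σ g =
      sch.c (σ 0) k * sch.c (σ 1) k * sch.a k ^ 8 *
        ∑ x ∈ box 4 (sch.L k), ∑ y ∈ box 4 (sch.L k),
          g 0 (sch.a k • siteToE x) * g 1 (sch.a k • siteToE y) *
            centredKernel ρ (sch.β k) (sch.side k) (obs (σ 0)) (obs (σ 1))
              (sch.m (σ 0) k) (sch.m (σ 1) k) x y := by
  set μ := wilsonMeasure (d := 4) (L := sch.side k) ρ (sch.β k) with hμ
  set A : Site 4 → GaugeConfig 4 (sch.side k) G → ℝ :=
    fun x U => obs (σ 0) (configShift (-x) (torusLift (sch.side k) U)) - sch.m (σ 0) k with hA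
  set B : Site 4 → GaugeConfig 4 (sch.side k) G → ℝ :=
    fun y U => obs (σ 1) (configShift (-y) (torusLift (sch.side k) U)) - sch.m (σ 1) k with hB
  have hIA : ∀ x, Integrable (A x) μ := fun x =>
    integrable_shift_lift ρ hρ _ _ (hmeas 0) (hbdd 0) x _
  have hIB : ∀ y, Integrable (B y) μ := fun y =>
    integrable_shift_lift ρ hρ _ _ (hmeas 1) (hbdd 1) y _
  have hIAB : ∀ x y, Integrable (fun U => A x U * B y U) μ := by
    intro x y
    obtain ⟨C₁, hC₁⟩ := hbdd 1
    refine (hIA x).mul_bdd (hIB y).aestronglyMeasurable (c := C₁ + |sch.m (σ 1) k|)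
      (ae_of_all _ fun U => ?_)
    rw [Real.norm_eq_abs]
    exact (abs_sub _ _).trans (add_le_add (hC₁ _) le_rfl)
  -- the integrand as a double sum
  have hint : ∀ U, (∏ i : Fin 2, smearedLatticeField (obs (σ i)) (box 4 (sch.L k)) (sch.a k)
      (sch.c (σ i) k) (sch.m (σ i) k) (g i) (torusLift (sch.side k) U)) =
      ∑ x ∈ box 4 (sch.L k), ∑ y ∈ box 4 (sch.L k),
        (sch.c (σ 0) k * sch.c (σ 1) k * sch.a k ^ 8 *
          (g 0 (sch.a k • siteToE x) * g 1 (sch.a k • siteToE y))) * (A x U * B y U) := by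
    intro U
    rw [Fin.prod_univ_two]
    simp only [smearedLatticeField]
    rw [mul_sum_mul_mul_sum]
    refine Finset.sum_congr rfl fun x _ => Finset.sum_congr rfl fun y _ => ?_
    simp only [hA, hB]
    ring
  unfold latticeSchwinger
  simp_rw [hint]
  rw [integral_finsetSum _ fun x _ => integrable_finsetSum _ fun y _ => (hIAB x y).const_mul _]
  rw [Finset.mul_sum]
  refine Finset.sum_congr rfl fun x _ => ?_
  rw [integral_finsetSum _ fun y _ => (hIAB x y).const_mul _, Finset.mul_sum]
  refine Finset.sum_congr rfl fun y _ => ?_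
  rw [integral_const_mul, centredKernel]
  ring

/-- **Exact centring makes the kernel a truncated correlation.** If `mᵢ = ⟨Oᵢ⟩_{S,β}` then
`K(x, y) = ⟨O₀ · (O₁ ∘ τ_{x−y})⟩ − ⟨O₀⟩ ⟨O₁ ∘ τ_{x−y}⟩` (translation invariance of the torus
state). [folklore] -/
theorem centredKernel_eq_cov (hρ : Continuous ρ) (β : ℝ) (S : ℕ) [NeZero S]
    {O₀ O₁ : LGConfig 4 G → ℝ} (hO₀ : Measurable O₀) (hO₁ : Measurable O₁)
    (hb₀ : ∃ C, ∀ U, |O₀ U| ≤ C) (hb₁ : ∃ C, ∀ U, |O₁ U| ≤ C) {m₀ m₁ : ℝ}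
    (h₀ : m₀ = wilsonExpectation (L := S) ρ β (toTorusObservable S O₀))
    (h₁ : m₁ = wilsonExpectation (L := S) ρ β (toTorusObservable S O₁)) (x y : Site 4) :
    centredKernel ρ β S O₀ O₁ m₀ m₁ x y =
      wilsonExpectation (L := S) ρ β
          (toTorusObservable S fun U => O₀ U * O₁ (configShift (x - y) U)) -
        wilsonExpectation (L := S) ρ β (toTorusObservable S O₀) *
          wilsonExpectation (L := S) ρ β (toTorusObservable S (O₁ ∘ configShift (x - y))) := by
  haveI := isProbabilityMeasure_wilsonMeasure (d := 4) (L := S) ρ hρ β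
  set μ := wilsonMeasure (d := 4) (L := S) ρ β with hμ
  set A : GaugeConfig 4 S G → ℝ := fun U => O₀ (configShift (-x) (torusLift S U)) with hA
  set B : GaugeConfig 4 S G → ℝ := fun U => O₁ (configShift (-y) (torusLift S U)) with hB
  -- translation invariance: `∫ A = m₀`, `∫ B = m₁`, `∫ A B = ⟨O₀ · O₁∘τ_{x-y}⟩`
  have hshift : ∀ (F : LGConfig 4 G → ℝ) (v : Site 4),
      ∫ U, F (configShift v (torusLift S U)) ∂μ =
        wilsonExpectation (L := S) ρ β (toTorusObservable S F) := by
    intro F v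
    have h := wilsonExpectation_comp_torusConfigShift (d := 4) (L := S) ρ β (Torus.proj S v)
      (toTorusObservable S F)
    rw [← toTorusObservable_comp_configShift] at h
    exact h
  have hEA : ∫ U, A U ∂μ = m₀ := by rw [h₀]; exact hshift O₀ (-x)
  have hEB : ∫ U, B U ∂μ = m₁ := by rw [h₁]; exact hshift O₁ (-y)
  have hEB' : wilsonExpectation (L := S) ρ β (toTorusObservable S (O₁ ∘ configShift (x - y))) =
      m₁ := by
    rw [h₁]; exact hshift O₁ (x - y)
  have hEAB : ∫ U, A U * B U ∂μ = wilsonExpectation (L := S) ρ β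
      (toTorusObservable S fun U => O₀ U * O₁ (configShift (x - y) U)) := by
    have hpt : ∀ U, A U * B U =
        (fun V => O₀ V * O₁ (configShift (x - y) V)) (configShift (-x) (torusLift S U)) := by
      intro U
      show A U * B U = O₀ (configShift (-x) (torusLift S U)) *
        O₁ (configShift (x - y) (configShift (-x) (torusLift S U)))
      rw [configShift_configShift, show x - y + -x = -y by abel]
    simp_rw [hpt]
    exact hshift (fun V => O₀ V * O₁ (configShift (x - y) V)) (-x)
  -- integrability
  have hIA : Integrable A μ := by
    simpa using integrable_shift_lift ρ hρ β S hO₀ hb₀ x 0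
  have hIB : Integrable B μ := by
    simpa using integrable_shift_lift ρ hρ β S hO₁ hb₁ y 0
  have hIAB : Integrable (fun U => A U * B U) μ := by
    obtain ⟨C₁, hC₁⟩ := hb₁
    refine hIA.mul_bdd hIB.aestronglyMeasurable (c := C₁) (ae_of_all _ fun U => ?_)
    rw [Real.norm_eq_abs]
    exact hC₁ _
  -- expand
  have hexp : (fun U => (A U - m₀) * (B U - m₁)) =
      fun U => A U * B U - m₀ * B U - m₁ * A U + m₀ * m₁ := by
    funext U; ring
  unfold centredKernel
  rw [show (fun U => (O₀ (configShift (-x) (torusLift S U)) - m₀) *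
      (O₁ (configShift (-y) (torusLift S U)) - m₁)) = fun U => (A U - m₀) * (B U - m₁) from rfl]
  have hI1 : Integrable (fun U => A U * B U - m₀ * B U) μ := hIAB.sub (hIB.const_mul m₀)
  have hI2 : Integrable (fun U => A U * B U - m₀ * B U - m₁ * A U) μ := hI1.sub (hIA.const_mul m₁)
  rw [hexp, integral_add hI2 (integrable_const _), integral_sub hI1 (hIA.const_mul m₁),
    integral_sub hIAB (hIB.const_mul m₀), integral_const_mul, integral_const_mul, integral_const,
    probReal_univ, one_smul, hEA, hEB, hEAB, hEB', ← h₀]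
  ring

/-- **Clustering transfers to the kernel.** If the torus truncated correlations of `O₀` and
`O₁ ∘ τ_z` on tori of side `L + 1` obey `≤ C e^{−m‖z‖}` whenever `2‖z‖ < L + 1`, then on the
torus of side `2L + 1`, with exact centring, `|K(x, y)| ≤ C e^{−m‖x−y‖}` for `‖x − y‖ ≤ L`.
[folklore] -/
theorem abs_centredKernel_le (hρ : Continuous ρ) {β m C : ℝ} {O₀ O₁ : LGConfig 4 G → ℝ}
    (hO₀ : Measurable O₀) (hO₁ : Measurable O₁)
    (hb₀ : ∃ C, ∀ U, |O₀ U| ≤ C) (hb₁ : ∃ C, ∀ U, |O₁ U| ≤ C)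
    (hcl : ∀ (L : ℕ) (z : Site 4), 2 * ‖z‖ < (L : ℝ) + 1 →
      |wilsonExpectation (L := L + 1) ρ β
            (toTorusObservable (L + 1) fun U => O₀ U * O₁ (configShift z U)) -
          wilsonExpectation (L := L + 1) ρ β (toTorusObservable (L + 1) O₀) *
            wilsonExpectation (L := L + 1) ρ β (toTorusObservable (L + 1) (O₁ ∘ configShift z))| ≤
        C * Real.exp (-m * ‖z‖))
    (L : ℕ) {m₀ m₁ : ℝ}
    (h₀ : m₀ = wilsonExpectation (L := 2 * L + 1) ρ β (toTorusObservable (2 * L + 1) O₀))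
    (h₁ : m₁ = wilsonExpectation (L := 2 * L + 1) ρ β (toTorusObservable (2 * L + 1) O₁))
    {x y : Site 4} (hxy : ‖x - y‖ ≤ L) :
    |centredKernel ρ β (2 * L + 1) O₀ O₁ m₀ m₁ x y| ≤ C * Real.exp (-(m * ‖x - y‖)) := by
  rw [centredKernel_eq_cov ρ hρ β (2 * L + 1) hO₀ hO₁ hb₀ hb₁ h₀ h₁ x y]
  have h := hcl (2 * L) (x - y) (by push_cast; linarith)
  rwa [neg_mul] at h

end TwoPoint

end Summit.QuantumFields.YangMills.Theorems.StrongCouplingIRTrivial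

end
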